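import Literature.MathematicalPhysics.QuantumFieldTheory.Balaban1983to89.B15Prop1JointHolomorphyFromBackground
import Literature.MathematicalPhysics.QuantumFieldTheory.Balaban1983to89.B15Prop1OneSidedIneq17OfFun

/-!
# `Balaban1983to89.B15Prop1OneSidedIneq17Edition` — [Balaban1989LargeFieldI] Prop. 1 p. 194 ∕ [Balaban1989LargeFieldII] p. 357, (1.7)–(1.9) p. 358:
# THE N12∕s1 ENDPOINT CHAIN RE-ISSUED WITH THE ONE-SIDED, γ₀-GENERIC (1.7) LETTER `h17` IN PLACE OF THE TWO-SIDED `hlead` — print's (1.7) AS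
# DISPLAYED («it is simple to estimate the lower bound», p. 357), the currency the D-0149 U2 lane (second variation ∕ linearised minimiser ∕ localized
# Federbush inequality) reaches at `n′ = 1`, γ₀ = 1 with no further estimate

Honest framing: statement-level skeleton of published theorems with citation tags; proofs where landed; nothing here is a claim about the Yang–Mills mass gap.

Cell pub-ymgap, HUMAN RULINGS D-0062 ∕ D-0149, seat `pub-ymgap-dag-n12-c` (R134 (a), s1 of node N12 = [B15]; g16).  PDFs held: `paper:balaban1989-cmp122-large-field-ii`
(pp. 357–359 = PDF 3–5, re-read first-hand: render p0003 «Consider now the quadratic form in the exponential in (1.2). This quadratic form is positive definite,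
and it is simple to estimate the lower bound … Now the leading quadratic form is equal to (B′, Δ_kB′) defined by (1.65), (1.66) [10]. Using the bound (1.67) [10]
for this form, we obtain (1.7)»).

WHY (seat n12-w4's LOCATED-1, pub-ymgap INBOX 2026-08-27T23:19Z, adopted by this lane).  Every N12∕s1 endpoint from `B15Prop1LocalLettersOfFun` up to
`B15Prop1JointHolomorphyFromBackground` (p583244) displays the (L2) letter TWO-SIDEDLY, `hlead : |⟪X, D(rGrad g)(0)X⟫ − Σ_a formDk n′ (ιA X)_a| ≤ Cerr‖X‖²`
(closeness of the slice Hessian of print's function (1.77) to the GLOBAL unweighted variational form (1.65)–(1.66) [10]), although the kernel consumes only its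
LOWER half: `B15Prop1LocalLettersRecord.prop1Printed_lfVarOn_su2_box_G0_of_167_local` turns `hlead` + (1.67) (`B15Prop1SliceIneq167.circ_le_sum_formDk`) into
the γ₀-generic one-sided letter `h17 : γ₀·circ(X) − Cerr‖X‖² ≤ Q(X)` of the root `B15Prop1LocalLettersSU2Box.prop1Printed_lfVarOn_su2_box_G0_of_17_ext193_local` at
γ₀ = (4∕π²)^{d+2}, and (1.8)–(1.9) follow from that half alone (the intrinsic layers use it a second time, for the Hessian coercivity behind the analytic clause,
through `B15Prop1IntrinsicAnalyticAtRecord.hessian_coercive_of_hlead` — again the lower half).  The U2 lane's combined output (n12-w2 `Node00.WilsonActionSecondVariation`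
p583639, n12-w3 `B11Eq177CriticalFamilyDerivative` p584027, n12-w4 `B16Ineq17LocalFederbush` p584067) is two-sided about the FLAT `Z`-LOCAL ζ₀-weighted form and
therefore ONE-SIDED about `formDk`: its lower half at `n′ = 1`, γ₀ = 1 is «zero estimates away» (localized Federbush + `formDk 1 = d1Sq`), whereas the upper half
needs print's two replacement steps («replacing the minimizer … by the k-th minimizer defined on the whole lattice, and the function ζ₀ by the function identically
equal to 1») = the exponential decay of the `Z`-local linearised minimiser, an L-sized estimate no seat owns.  THIS MODULE re-issues the seven theorems of the chain
from the root up with the root's own letter — γ₀ a parameter, `h17` one-sided, `hsm`∕`hγle` in γ₀-form — so that EVERY lower-bound route feeds the N12∕s1 endpoint: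
the two-sided `hlead` (by `ineq17_of_lead` + `circ_le_sum_formDk`), a one-sided `hlead⁻`, or the flat-Federbush `Ineq17` at γ₀ = 1 (n12-w4's announced slice-currency
feeder).  Statements are those of the source theorems VERBATIM but for `(n′) (hn′) … (hlead) (hsm) (hγle)` ↦ `{γ₀} (hγ₀) … (h17) (hsm) (hγle)` (same positions);
proofs are the source proofs with the one-sided lemma `hessian_coercive_of_h17` (§0) in place of `hessian_coercive_of_hlead` and the first layer calling the
γ₀-generic root directly.

WHAT THIS FILE PROVES (no `sorry`, no definition; axioms standard).
(§0–§2 — `hessian_coercive_of_h17`, the `ofFun` and intrinsic `ofFun` layers — are the companion `B15Prop1OneSidedIneq17OfFun`, imported.)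
§3 ★★ `exists_domain_prop1Printed_lfVarOn_std_su2_box_intrinsic_analytic_atZSeqCoPRecord_ofNearValue_oneSided` (twin of `B15Prop1AtZSequenceRecord` §2),
   ★★★ `…_atZSeqCoPRecord_ofThm1Guarded_oneSided`, `…_atZSeqCoPRecord_ofThm1TorusClass_oneSided` (twins of `B15Prop1Thm1GeneralFormShapes` §4),
   ★★★ `…_atZSeqCoPRecord_ofThm1TorusClass_ofValueMatched_oneSided` (twin of `B15Prop1JointHolomorphyFromBackground` §4) — THE N12∕s1 ENDPOINT OF RECORD WITH THE
   ONE-SIDED (L2) LETTER: per instance (J0ᵛ) `hBg`, (L2⁻) `h17` + `hsm`∕`hγle` (γ₀-form), `hfar`, (Gᵃ) `hZblk`; once per run `h15T`; bookkeeping; structure.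

HONEST SCOPE.  Binder surgery only: nothing of Bałaban asserted; (1.7) in either form, (J0ᵛ), the [15] letter remain LETTERS (the one-sided (L2) is WEAKER than
the two-sided one, so these endpoints are STRONGER theorems than their sources, proved by the same kernel argument); count-neutral; NOT a discharge of N12; nothing
continuum ∕ OS ∕ mass-gap ∕ Clay.  No `def`, no `instance`, no `sorry`.

## References
* [Balaban1989LargeFieldI] T. Bałaban, Commun. Math. Phys. 122 (1989) 175–202, (1.74) p. 192, p. 193, Prop. 1 (1.77)–(1.78) p. 194, (1.79) p. 195.
* [Balaban1989LargeFieldII] T. Bałaban, Commun. Math. Phys. 122 (1989) 355–392, p. 357, (1.7)–(1.9) p. 358, (1.11)–(1.13) p. 359.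
* [Balaban1985Variational] T. Bałaban, Commun. Math. Phys. 102 (1985) 277–309, (1) p. 277, Thm 1 (8) p. 279, Prop. 4 pp. 292–293, (181) p. 307, Prop. 9 (190) p. 309.
* [Balaban1988Convergent] T. Bałaban, Commun. Math. Phys. 119 (1988) 243–285, (2.12)–(2.14) pp. 256–257, (2.16)–(2.18) p. 257.
* [Balaban1984PropagatorsI] T. Bałaban, Commun. Math. Phys. 95 (1984) 17–40, (1.65)–(1.67) p. 29.
-/

noncomputable section

open Set Finset Metric
open scoped BigOperators Matrix RealInnerProductSpace Real InnerProductSpace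

namespace Literature.MathematicalPhysics.QuantumFieldTheory.Balaban1983to89.B15Prop1OneSidedIneq17Edition

open B15DeterminingSets GaugeField B16Sect1Backgrounds B15Prop1Carrier B8Eq17ClassAkV1 BlockAveraging
open B15Prop1SliceTaylorCalculus B15Prop1IntrinsicAnalyticExt B15Prop1ParametricZeroBranch B15Prop1LocalLettersOfFun B15Prop1IntrinsicOfFun
open B15Prop1IntrinsicOfRecord B15Prop1GradientFromNearValue B15Prop1GradientFromNearValueAtCoPRecord
open B15Prop1AtZSequenceRecord B15Prop1DatumSmall7AtZSequence B15Prop1Thm1GeneralFormAtZSequence B15Prop1Thm1GeneralFormShapes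
open B15Prop1JointHolomorphyFromBackground B15Prop1OneSidedIneq17OfFun
open B15Prop1CarrierOnSU2BoxExt193 (thresholds_exist)
open B15Prop1LipschitzFromProp4 (dV_zero_real_of_prop4Hyp lipschitz_real_of_prop4Hyp)
open B15Prop1AdjointOfRecord (norm_adjoint_apply_le)
open B15Prop1IntrinsicReading (prop4Hyp_congr)
open B15Prop1CriticalViaSlice (isCriticalPt_iff_of_hasDerivAt)
open B15Prop1CriticalAtBoxG0 (treeOrder_G0 tgt_G0_mem)
open B15Prop1ChartRecentering (exists_hasFDerivAt_of_differentiableAt)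
open B15Prop1LocalLettersSU2Box (prop1Printed_lfVarOn_su2_box_G0_of_17_ext193_local)
open B15Prop1SliceIneq18 (ineq19_slice_of_17)
open B15Prop1AnalyticExtClause (cplxVec cplxSlice cplxSlice_apply norm_cplxSlice norm_cplxVec reSlice anExt anExt_antitone)
open B15Prop1ChartCalculusSU2 (E3)
open T4CubeChartGnomonic (SU2)
open B15Prop1ChartSU2 (su2Chart)
open B15Prop1SliceCoordinates (GaugeSlice ιA freeBonds norm_ιA_apply_le)
open T4AxialGaugeSmallField (castSite boxPlaqs)
open T4AxialGaugeFixing (TreeOrder boxDepth)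
open B7Prop1Explicit (e e_apply)
open B6BondElimination (unitVec)
open B6TreeGaugePoincare (curl)
open B16Eq18Proof (box mem_box)
open B15Extension193 (extend)
open B15ShellGauge193 (shellGauge)
open B5Bounds167Lattice (formDk ofRealCfg)
open B14DomainGeom (IsUnionOfCubes)
open B15Eq112TorusCover (cover)
open B14.Eq213MaximalDomains (side)
open B14.Eq213DetSet B14.Eq216Concrete B15Sect1Instances B15Eq177GaugeInvariance B15Eq177ValueInvariance B15Eq177ValueInvarianceCoDiv B16Sect1Wilson
open B14.Eq22Determines (blockIter IsBlockUnion)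
open Literature.MathematicalPhysics.QuantumFieldTheory.BalabanImbrieJaffe1984to88.BIJ85Eq453GaugeField
open B11Prop6Scheme (Prop4Hyp)
open T4Continuum
open Classical

/-! ## §3 The `Z`-sequence, guarded-[15]-letter and value-matched endpoints with the one-sided letter -/

section AtRecord

/-- **ONE-SIDED (γ₀-generic (1.7)) edition** (the two-sided `hlead` of the source replaced by `h17`, `hsm`∕`hγle` in γ₀-form). ★★★ **PROPOSITION 1 [IV] WITH ITS ANALYTIC-EXTENSION CLAUSE AT PRINT'S (1.74) OBJECT, WITH THE GRADIENT LETTER (L3) REPLACED BY THE NEAR-FIELD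
VALUE LETTER (Vn)** — per instance the background `Node00.bgMSCoPOfRecord F 2 ν Kt (k i) (maxDomT ν.M₁ (Z i))` (NODE 00's constructor of record at
`Z`'s own maximal sequence, support `hull(Ω₁(Z))`; class invariance DISCHARGED by `gaugeAct_mem_regMSCoPOfRecord`); SUPERSEDES
`B15Prop1GradientFromNearValueAtCoPRecord.…_atCoPRecord_ofNearValue` (p540333 §1; same letters, background of the RUN's class) for consumption.  WHAT A
CONSUMER SUPPLIES: (J1) `hGj`, (L2) `h17` + `hsm`∕`hγle`, (Vn) `hVn : Σ_{p ∈ plaqsOf Ω₁(Z)} (1 − Re tr U_{k,Z}(ext V_k)(∂p)) ≤ cA·ε²` at `ε`-regular data —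
print's (8) for `U_{k,Z}` ([IV] p. 193 ll. 17–20; at this background = [15] Thm 1 (8) for the admissible sequence `maxDomT ν.M₁ Z`, LOCATED-GENFORM of the
module docstring) via `B15Prop1GradientFromNearValueAtCoPRecord.nearValue_le_of_plaqSmallOn` — `hcJ' : 2cA·eR∕R + 4𝓐∕(R·eR) ≤ cJ`, the geometric letter
`hfar` (`…AtCoPRecord.far_letter_of_box`), `0 < k i ≤ m + K`, structure, `hcl := Subsingleton.elim _ _`.
[cite: Balaban1989LargeFieldI, (1.74) p.192, Prop. 1 (1.77)–(1.78) p.194 (incl. the last clause), p.193; Balaban1988Convergent, p.255, (2.12)–(2.13) pp.256–257;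
Balaban1985Variational, (2),(5),(6) p.278, Thm 1 (8) p.279, Prop. 9 p.309; Balaban1989LargeFieldII, (1.7)–(1.9) p.358, (1.11) p.358, (1.12)–(1.13) p.359] -/
theorem exists_domain_prop1Printed_lfVarOn_std_su2_box_intrinsic_analytic_atZSeqCoPRecord_ofNearValue_oneSided {F : T4Family}
    (ν : Node00.Stage7Numerics) (Kt : ℕ) (hd3 : 3 ≤ (F.P Kt).d) (h0 : 0 < (F.P Kt).d) {ι : Type}
    [hdec : ∀ j, DecidableEq (PBond (F.P Kt) j)] (hcl : hdec = fun _ a b => Classical.propDecidable (a = b))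
    (Z Λ : ι → Set (Site (F.P Kt) 0)) (k : ι → ℕ) (M : ι → ℝ) (hk0 : ∀ i, 0 < k i) (hk : ∀ i, k i ≤ (F.P Kt).m + (F.P Kt).K)
    (eR : ι → ℝ) (heR : ∀ i, 0 < eR i)
    (T : ∀ i, Finset (PBond (F.P Kt) (k i)))
    (lo hi : ι → Fin (F.P Kt).d → ℤ) (n : ι → ℕ) (hn : ∀ i κ, hi i κ ≤ lo i κ + n i) (hN : ∀ i, n i + 2 < (F.P Kt).sitesPerDir (k i))
    (hbox : ∀ i, pts (k i) (Λ i) = (castSite '' Set.Icc (lo i) (hi i) : Set (Site (F.P Kt) (k i))))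
    (hZ : ∀ i, (boxPlaqs (lo i - 1) (hi i + 1) : Set (Plaq (F.P Kt) (k i))) ⊆ plaqsInside (pts (k i) (Z i)))
    (hTG0 : ∀ i, T i = (box (fun κ => (hi i κ - lo i κ + 1).toNat) (lo i)).image fun x =>
      (⟨castSite (x - unitVec ⟨0, h0⟩), ⟨0, h0⟩⟩ : PBond (F.P Kt) (k i)))
    (hN5 : ∀ i κ, ((hi i κ - lo i κ + 1).toNat : ℤ) + 5 < (F.P Kt).sitesPerDir (k i))
    (K : ι → ℕ) (hK1 : ∀ i, 1 ≤ K i) (hKn : ∀ i κ, (hi i κ - lo i κ + 1).toNat ≤ K i)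
    (ext : ∀ i, GaugeField (F.P Kt) (k i) SU2 → GaugeField (F.P Kt) (k i) SU2)
    (hext : ∀ i Vk, ext i Vk = extend (pts (k i) (Λ i)) (shellGauge Vk (lo i) (hi i)) Vk)
    (hlohi : ∀ i, lo i ≤ hi i)
    {γ cJ bx : ℝ} (hγ : 0 < γ) (hcJ : 0 ≤ cJ) (hbx : 0 ≤ bx)
    (hbxM : ∀ i, 12 * ((F.P Kt).d : ℝ) * ((n i : ℝ) + 2) ^ 2 ≤ bx * (M i) ^ 2)
    {Cerr R 𝓐 : ι → ℝ} (hM : ∀ i, 1 ≤ (M i)) (hR : ∀ i, 0 < R i) (h𝓐 : ∀ i, 0 ≤ 𝓐 i)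
    {γ₀ : ℝ} (hγ₀ : 0 ≤ γ₀)
    -- (J1) the JOINT holomorphic extension of print's function in the datum perturbation and the field
    (hGj : ∀ i Vk, PlaqSmallOn (plaqsInside (pts (k i) (Z i ∩ (Λ i)ᶜ))) (eR i) Vk →
      ∃ 𝒢 : VecField (F.P Kt) (k i) (EuclideanSpace ℂ (Fin 3)) × VecField (F.P Kt) (k i) (EuclideanSpace ℂ (Fin 3)) → ℂ,
        DifferentiableOn ℂ 𝒢 (ball 0 (R i)) ∧
        (∀ z ∈ ball (0 : VecField (F.P Kt) (k i) (EuclideanSpace ℂ (Fin 3)) × VecField (F.P Kt) (k i) (EuclideanSpace ℂ (Fin 3))) (R i), ‖𝒢 z‖ ≤ 𝓐 i) ∧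
        ∀ p B' : VecField (F.P Kt) (k i) E3, ‖p‖ < R i → ‖B'‖ < R i →
          𝒢 (cplxVec p, cplxVec B') =
            ((fun177std (Node00.bgMSCoPOfRecord F 2 ν Kt (k i) (maxDomT ν.M₁ (Z i))) ν.M₁ (Z i) (k i)
              (expMul su2Chart B' (ext i (expMul su2Chart p Vk))) : ℝ) : ℂ))
    -- (L2) (1.7)–(1.9) p.358 for the Hessian of the slice function at `0`
    (h17 : ∀ i Vk, PlaqSmallOn (plaqsInside (pts (k i) (Z i ∩ (Λ i)ᶜ))) (eR i) Vk → ∀ X : GaugeSlice (pts (k i) (Λ i)) (T i) E3,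
      γ₀ * (∑ z ∈ box (fun κ => (hi i κ - lo i κ + 1).toNat + 3) (fun κ => lo i κ - 2), ∑ μ : Fin (F.P Kt).d, ∑ a : Fin 3,
          curl (fun b => ιA (pts (k i) (Λ i)) (T i) X (⟨castSite b.1, b.2⟩ : PBond (F.P Kt) (k i)) a) z ⟨0, h0⟩ μ ^ 2) -
        Cerr i * ‖X‖ ^ 2 ≤ ⟪X, (fderiv ℝ (rGrad (pts (k i) (Λ i)) (T i)
              (sliceFn (pts (k i) (Λ i)) (T i)
                (fun177std (Node00.bgMSCoPOfRecord F 2 ν Kt (k i) (maxDomT ν.M₁ (Z i))) ν.M₁ (Z i) (k i)) (ext i Vk))) 0) X⟫)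
    (hsm : ∀ i, Cerr i ≤ γ₀ / (2 * (3 * (K i : ℝ) ^ 2 + 2 * (K i : ℝ) ^ 4)))
    (hγle : ∀ i, γ / (M i) ^ 5 ≤ γ₀ / (2 * (3 * (K i : ℝ) ^ 2 + 2 * (K i : ℝ) ^ 4)))
    -- the geometric letter: the k-blocks over the bonds meeting `Λ^{(k)}` lie inside `Ω₁(Z)` (print: `Λ` deep inside `Z`)
    (hfar : ∀ i (b : PBond (F.P Kt) 0), b.src ∉ maxDomT ν.M₁ (Z i) 1 →
      (⟨blockIter (k i) b.src, b.dir⟩ : PBond (F.P Kt) (k i)) ∉ bondsOf (pts (k i) (Λ i)))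
    -- (Vn) the NEAR-FIELD part of (1.77) at the extended regular datum is small (replaces (L3))
    {cA : ℝ}
    (hVn : ∀ i ε Vk, 0 < ε → ε ≤ eR i → PlaqSmallOn (plaqsInside (pts (k i) (Z i ∩ (Λ i)ᶜ))) ε Vk →
      wilsonLoc ((plaqsOf (maxDomT ν.M₁ (Z i) 1)).indicator fun _ => (1 : ℝ))
        (bgKZstd (Node00.bgMSCoPOfRecord F 2 ν Kt (k i) (maxDomT ν.M₁ (Z i))) ν.M₁ (Z i) (k i) (ext i Vk)) ≤ cA * ε ^ 2)
    (hcJ' : ∀ i, 2 * cA * eR i / R i + 4 * 𝓐 i / (R i * eR i) ≤ cJ)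
    : ∃ a₁ : ι → ℝ, (∀ i, 0 < a₁ i) ∧
      B15.Prop1Printed (lfVarOn su2Chart fun i =>
        InstOn.std (Node00.bgMSCoPOfRecord F 2 ν Kt (k i) (maxDomT ν.M₁ (Z i))) ν.M₁ (Z i) (Λ i) (k i) (M i) (a₁ i)
          (anExt (pts (k i) (Λ i)) (T i)
            (fun177std (Node00.bgMSCoPOfRecord F 2 ν Kt (k i) (maxDomT ν.M₁ (Z i))) ν.M₁ (Z i) (k i)) (ext i)
            (min (1 / 2) (min (R i / 8) (γ / (M i) ^ 5 * (R i / 2) ^ 2 / (48 * (4 * 𝓐 i / R i + 1))))))) := by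
  subst hcl
  exact exists_domain_prop1Printed_lfVarOn_ofFun_intrinsic_analytic_oneSided hd3 h0 Z Λ k M
    (fun i => fun177std (Node00.bgMSCoPOfRecord F 2 ν Kt (k i) (maxDomT ν.M₁ (Z i))) ν.M₁ (Z i) (k i))
    (fun i u V => fun177std_bgOfRecord_gaugeAct (Node00.avOfRecord F 2 Kt)
      (gaugeAct_mem_regMSCoPOfRecord ν Kt (k i) (maxDomT ν.M₁ (Z i))) ν.M₁ (Z i) (hk i) u V)
    eR heR T lo hi n hn hN hbox hZ hTG0 hN5 K hK1 hKn ext hext hlohi hγ hcJ hbx hbxM hM hR h𝓐 hγ₀ hGj h17 hsm hγle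
    (hJ_of_nearValue Z Λ k
      (fun i => fun177std (Node00.bgMSCoPOfRecord F 2 ν Kt (k i) (maxDomT ν.M₁ (Z i))) ν.M₁ (Z i) (k i))
      (fun i V => wilsonLoc ((plaqsOf (maxDomT ν.M₁ (Z i) 1)).indicator fun _ => (1 : ℝ))
        (bgKZstd (Node00.bgMSCoPOfRecord F 2 ν Kt (k i) (maxDomT ν.M₁ (Z i))) ν.M₁ (Z i) (k i) V))
      (fun _ _ => wilsonLoc_nonneg _ _ fun p => Set.indicator_nonneg (fun _ _ => zero_le_one) p) eR heR T ext hR hGj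
      (fun i Vk _ => fun177std_dichotomy (Node00.avOfRecord F 2 Kt)
        (Node00.regMSCoPOfRecord F 2 ν Kt (k i) (maxDomT ν.M₁ (Z i))) ν.M₁ (hk0 i) (hk i) (T i) (hfar i) (ext i Vk))
      hVn hcJ')

/-- **ONE-SIDED (γ₀-generic (1.7)) edition** (the two-sided `hlead` of the source replaced by `h17`, `hsm`∕`hγle` in γ₀-form). ★★★ **PROPOSITION 1 [IV] WITH ITS ANALYTIC-EXTENSION CLAUSE AT PRINT'S (1.74) OBJECT, THE [15] LETTER IN GUARDED CLOSED FORM** — g12's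
`…_atZSeqCoPRecord_ofThm1General` VERBATIM with `h15D` REPLACED by the guarded `h15G` (see `nearValue_letter_of_thm1Guarded`); every other binder unchanged.
WHAT A CONSUMER SUPPLIES per instance: (J1) `hGj`, (L2) `h17` + `hsm`∕`hγle` (NODE 00's), `hfar`, (Gᵃ) `hZblk`, `0 < k i ≤ m + K`, structure, numerics
(`hcE`∕`heRa`∕`hB₃`∕`hcA`∕`ha₀`∕`hcJ'`), `hM2`, `hdiv`, `hcl := Subsingleton.elim _ _`; and ONCE per run: `h15G` (or, in NODE 00's house shape, `h15T`: `…_ofThm1TorusClass`).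
[cite: Balaban1989LargeFieldI, (1.74) p.192, Prop. 1 (1.77)–(1.78) p.194 (incl. the last clause), p.193, (1.79) p.195; Balaban1988Convergent, (2.1) p.254, p.255, (2.12)–(2.13)
pp.256–257, (2.16), (2.18) p.257; Balaban1985Variational, (1) p.277, (2),(5),(6),(7) p.278, Thm 1 (8) p.279, Prop. 9 p.309; Balaban1989LargeFieldII, (1.7)–(1.9) p.358, (1.11)
p.358, (1.12)–(1.13) p.359] -/
theorem exists_domain_prop1Printed_lfVarOn_std_su2_box_intrinsic_analytic_atZSeqCoPRecord_ofThm1Guarded_oneSided {F : T4Family}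
    (ν : Node00.Stage7Numerics) (Kt : ℕ) (hd3 : 3 ≤ (F.P Kt).d) (h0 : 0 < (F.P Kt).d) {ι : Type}
    [hdec : ∀ j, DecidableEq (PBond (F.P Kt) j)] (hcl : hdec = fun _ a b => Classical.propDecidable (a = b))
    (Z Λ : ι → Set (Site (F.P Kt) 0)) (k : ι → ℕ) (M : ι → ℝ) (hk0 : ∀ i, 0 < k i) (hk : ∀ i, k i ≤ (F.P Kt).m + (F.P Kt).K)
    (eR : ι → ℝ) (heR : ∀ i, 0 < eR i)
    (T : ∀ i, Finset (PBond (F.P Kt) (k i)))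
    (lo hi : ι → Fin (F.P Kt).d → ℤ) (n : ι → ℕ) (hn : ∀ i κ, hi i κ ≤ lo i κ + n i) (hN : ∀ i, n i + 2 < (F.P Kt).sitesPerDir (k i))
    (hbox : ∀ i, pts (k i) (Λ i) = (castSite '' Set.Icc (lo i) (hi i) : Set (Site (F.P Kt) (k i))))
    (hZ : ∀ i, (boxPlaqs (lo i - 1) (hi i + 1) : Set (Plaq (F.P Kt) (k i))) ⊆ plaqsInside (pts (k i) (Z i)))
    (hTG0 : ∀ i, T i = (box (fun κ => (hi i κ - lo i κ + 1).toNat) (lo i)).image fun x =>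
      (⟨castSite (x - unitVec ⟨0, h0⟩), ⟨0, h0⟩⟩ : PBond (F.P Kt) (k i)))
    (hN5 : ∀ i κ, ((hi i κ - lo i κ + 1).toNat : ℤ) + 5 < (F.P Kt).sitesPerDir (k i))
    (K : ι → ℕ) (hK1 : ∀ i, 1 ≤ K i) (hKn : ∀ i κ, (hi i κ - lo i κ + 1).toNat ≤ K i)
    (ext : ∀ i, GaugeField (F.P Kt) (k i) SU2 → GaugeField (F.P Kt) (k i) SU2)
    (hext : ∀ i Vk, ext i Vk = extend (pts (k i) (Λ i)) (shellGauge Vk (lo i) (hi i)) Vk)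
    (hlohi : ∀ i, lo i ≤ hi i)
    {γ cJ bx : ℝ} (hγ : 0 < γ) (hcJ : 0 ≤ cJ) (hbx : 0 ≤ bx)
    (hbxM : ∀ i, 12 * ((F.P Kt).d : ℝ) * ((n i : ℝ) + 2) ^ 2 ≤ bx * (M i) ^ 2)
    {Cerr R 𝓐 : ι → ℝ} (hM : ∀ i, 1 ≤ (M i)) (hR : ∀ i, 0 < R i) (h𝓐 : ∀ i, 0 ≤ 𝓐 i)
    {γ₀ : ℝ} (hγ₀ : 0 ≤ γ₀)
    -- (J1) the JOINT holomorphic extension of print's function in the datum perturbation and the field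
    (hGj : ∀ i Vk, PlaqSmallOn (plaqsInside (pts (k i) (Z i ∩ (Λ i)ᶜ))) (eR i) Vk →
      ∃ 𝒢 : VecField (F.P Kt) (k i) (EuclideanSpace ℂ (Fin 3)) × VecField (F.P Kt) (k i) (EuclideanSpace ℂ (Fin 3)) → ℂ,
        DifferentiableOn ℂ 𝒢 (ball 0 (R i)) ∧
        (∀ z ∈ ball (0 : VecField (F.P Kt) (k i) (EuclideanSpace ℂ (Fin 3)) × VecField (F.P Kt) (k i) (EuclideanSpace ℂ (Fin 3))) (R i), ‖𝒢 z‖ ≤ 𝓐 i) ∧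
        ∀ p B' : VecField (F.P Kt) (k i) E3, ‖p‖ < R i → ‖B'‖ < R i →
          𝒢 (cplxVec p, cplxVec B') =
            ((fun177std (Node00.bgMSCoPOfRecord F 2 ν Kt (k i) (maxDomT ν.M₁ (Z i))) ν.M₁ (Z i) (k i)
              (expMul su2Chart B' (ext i (expMul su2Chart p Vk))) : ℝ) : ℂ))
    -- (L2) (1.7)–(1.9) p.358 for the Hessian of the slice function at `0`
    (h17 : ∀ i Vk, PlaqSmallOn (plaqsInside (pts (k i) (Z i ∩ (Λ i)ᶜ))) (eR i) Vk → ∀ X : GaugeSlice (pts (k i) (Λ i)) (T i) E3,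
      γ₀ * (∑ z ∈ box (fun κ => (hi i κ - lo i κ + 1).toNat + 3) (fun κ => lo i κ - 2), ∑ μ : Fin (F.P Kt).d, ∑ a : Fin 3,
          curl (fun b => ιA (pts (k i) (Λ i)) (T i) X (⟨castSite b.1, b.2⟩ : PBond (F.P Kt) (k i)) a) z ⟨0, h0⟩ μ ^ 2) -
        Cerr i * ‖X‖ ^ 2 ≤ ⟪X, (fderiv ℝ (rGrad (pts (k i) (Λ i)) (T i)
              (sliceFn (pts (k i) (Λ i)) (T i)
                (fun177std (Node00.bgMSCoPOfRecord F 2 ν Kt (k i) (maxDomT ν.M₁ (Z i))) ν.M₁ (Z i) (k i)) (ext i Vk))) 0) X⟫)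
    (hsm : ∀ i, Cerr i ≤ γ₀ / (2 * (3 * (K i : ℝ) ^ 2 + 2 * (K i : ℝ) ^ 4)))
    (hγle : ∀ i, γ / (M i) ^ 5 ≤ γ₀ / (2 * (3 * (K i : ℝ) ^ 2 + 2 * (K i : ℝ) ^ 4)))
    -- the geometric letter: the k-blocks over the bonds meeting `Λ^{(k)}` lie inside `Ω₁(Z)` (print: `Λ` deep inside `Z`)
    (hfar : ∀ i (b : PBond (F.P Kt) 0), b.src ∉ maxDomT ν.M₁ (Z i) 1 →
      (⟨blockIter (k i) b.src, b.dir⟩ : PBond (F.P Kt) (k i)) ∉ bondsOf (pts (k i) (Λ i)))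
    -- (Gᵃ) geometry of `Z`: a union of `k`-blocks (print's `Z` is a union of `M`-cubes of `T₁^{(k)}`; §4 derives it from the cube letter on the cover)
    (hZblk : ∀ i, IsBlockUnion (k i) (Z i))
    -- print's `M₁ ≥ 2` and the torus divisibility `L^{k}M₁ ∣ 2L^{m+K}` of the `LʲM₁`-cube partitions
    (hM2 : 2 ≤ ν.M₁) (hdiv : ∀ i, side (F.P Kt).L ν.M₁ (k i) ∣ (F.P Kt).sitesPerDir 0)
    -- bookkeeping constants
    {cE B₃ a₀ a₁' cA : ℝ} (hcE0 : 0 ≤ cE) (hcE : ∀ i, 12 * ((F.P Kt).d : ℝ) * ((n i : ℝ) + 2) ^ 2 ≤ cE) (hB₃ : 0 ≤ B₃)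
    (heRa : ∀ i, (cE + 1) * eR i ≤ a₁' ∧ B₃ * ((cE + 1) * eR i) ≤ ν.εreg) (ha₀ : ν.εreg ≤ a₀)
    (hcA : 1 / 2 * (B₃ * (cE + 1) * (F.P Kt).eta 1 ^ 2) ^ 2 * (Fintype.card (Plaq (F.P Kt) 0) : ℝ) ≤ cA)
    -- [15] THEOREM 1 (R), GUARDED CLOSED GENERAL-SEQUENCE FORM at `ν`, `Kt` (see `nearValue_letter_of_thm1Guarded`)
    (h15G : ∀ (k' : ℕ), k' ≤ (F.P Kt).m + (F.P Kt).K → side (F.P Kt).L ν.M₁ k' ∣ (F.P Kt).sitesPerDir 0 →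
      ∀ (D : ℕ → Set (Set (Site (F.P Kt) 0))) (s : B14.Eq218Concrete.Seq D k'),
      (∀ j, 1 ≤ j → j ≤ k' → IsUnionOfCubes (side (F.P Kt).L ν.M₁ j) (cover (F.P Kt) ⁻¹' s.Ω j)) →
      Node00.Sect2.SeqSeparated ν.M₁ s → 0 < ν.M₁ →
      ∀ (ε₀ : ℝ) (δ : ℕ → ℝ), (∀ j, j ≤ k' → 0 < δ j ∧ δ j ≤ a₁' ∧ B₃ * δ j ≤ ε₀) → (∀ j, j < k' → δ j ≤ 2 * δ (j + 1)) →
      (∀ j, j < k' → δ (j + 1) ≤ 2 * δ j) → ε₀ ≤ a₀ →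
      ∀ W : MSField (F.P Kt) SU2,
        Node00.Sect2.DataSmall7PTop (Node00.avOfRecord F 2 Kt) s.Ω (Node00.suppDomOfRecord F ν Kt s.Ω) k' δ W →
        ∀ U₀ : GaugeField (F.P Kt) 0 SU2, IsMinimizer (Node00.avOfRecord F 2 Kt)
            {U | (∀ j, j ≤ k' → PlaqSmallOn (Node00.Sect2.omegaPlaqsTop s.Ω (Node00.suppDomOfRecord F ν Kt s.Ω) j)
                (ε₀ * (F.P Kt).eta j ^ 2) U) ∧
              Node00.Sect2.CoDivClassOnTop s.Ω (Node00.suppDomOfRecord F ν Kt s.Ω) k' ε₀ U}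
            (genSet s.Ω k') W U₀ →
          (∀ j, j ≤ k' → PlaqSmallOn (Node00.Sect2.omegaPlaqsTop s.Ω (Node00.suppDomOfRecord F ν Kt s.Ω) j)
              (B₃ * δ j * (F.P Kt).eta j ^ 2) U₀) ∧
            ∀ j, j ≤ k' → Node00.Sect2.CoDivSmallOn (Node00.Sect2.omegaBondsTop s.Ω (Node00.suppDomOfRecord F ν Kt s.Ω) j)
              (B₃ * δ j * (F.P Kt).eta j ^ 3) U₀)
    (hcJ' : ∀ i, 2 * cA * eR i / R i + 4 * 𝓐 i / (R i * eR i) ≤ cJ)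
    : ∃ a₁ : ι → ℝ, (∀ i, 0 < a₁ i) ∧
      B15.Prop1Printed (lfVarOn su2Chart fun i =>
        InstOn.std (Node00.bgMSCoPOfRecord F 2 ν Kt (k i) (maxDomT ν.M₁ (Z i))) ν.M₁ (Z i) (Λ i) (k i) (M i) (a₁ i)
          (anExt (pts (k i) (Λ i)) (T i)
            (fun177std (Node00.bgMSCoPOfRecord F 2 ν Kt (k i) (maxDomT ν.M₁ (Z i))) ν.M₁ (Z i) (k i)) (ext i)
            (min (1 / 2) (min (R i / 8) (γ / (M i) ^ 5 * (R i / 2) ^ 2 / (48 * (4 * 𝓐 i / R i + 1))))))) :=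
  exists_domain_prop1Printed_lfVarOn_std_su2_box_intrinsic_analytic_atZSeqCoPRecord_ofNearValue_oneSided ν Kt hd3 h0 hcl Z Λ k M hk0 hk eR heR
    T lo hi n hn hN hbox hZ hTG0 hN5 K hK1 hKn ext hext hlohi hγ hcJ hbx hbxM hM hR h𝓐 hγ₀ hGj h17 hsm hγle hfar
    (nearValue_letter_of_thm1Guarded ν Kt hd3 Z Λ k hk0 hk eR lo hi n hn hbox hZ hN5 ext hext hlohi hZblk hM2 hdiv hcE0 hcE hB₃
      heRa ha₀ hcA h15G) hcJ'

/-- **ONE-SIDED (γ₀-generic (1.7)) edition** (the two-sided `hlead` of the source replaced by `h17`, `hsm`∕`hγle` in γ₀-form). ★★★ **PROPOSITION 1 [IV] AT PRINT'S (1.74) OBJECT, THE [15] LETTER IN NODE 00's HOUSE SHAPE** — `…_ofThm1Guarded` with the guarded letter taken over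
NODE 00's torus-native class `fun j => Node00.unionsOfCubes P (LʲM₁)` (`h15T`, the shape of `Node00.DOfRecord`-indexed facts with `M·R_j` replaced by print's
[15] (1) cube size `M₁`); one line by `thm1Guarded_of_thm1TorusClass`.  Every other binder as in `…_ofThm1Guarded`.
[cite: Balaban1989LargeFieldI, (1.74) p.192, Prop. 1 (1.77)–(1.78) p.194 (incl. the last clause), p.193, (1.79) p.195; Balaban1988Convergent, (2.1) p.254, p.255, (2.12)–(2.13)
pp.256–257, (2.16)–(2.18) p.257; Balaban1985Variational, (1) p.277, (2),(5),(6),(7) p.278, Thm 1 (8) p.279, Prop. 9 p.309; Balaban1989LargeFieldII, (1.7)–(1.9) p.358, (1.11)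
p.358, (1.12)–(1.13) p.359] -/
theorem exists_domain_prop1Printed_lfVarOn_std_su2_box_intrinsic_analytic_atZSeqCoPRecord_ofThm1TorusClass_oneSided {F : T4Family}
    (ν : Node00.Stage7Numerics) (Kt : ℕ) (hd3 : 3 ≤ (F.P Kt).d) (h0 : 0 < (F.P Kt).d) {ι : Type}
    [hdec : ∀ j, DecidableEq (PBond (F.P Kt) j)] (hcl : hdec = fun _ a b => Classical.propDecidable (a = b))
    (Z Λ : ι → Set (Site (F.P Kt) 0)) (k : ι → ℕ) (M : ι → ℝ) (hk0 : ∀ i, 0 < k i) (hk : ∀ i, k i ≤ (F.P Kt).m + (F.P Kt).K)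
    (eR : ι → ℝ) (heR : ∀ i, 0 < eR i)
    (T : ∀ i, Finset (PBond (F.P Kt) (k i)))
    (lo hi : ι → Fin (F.P Kt).d → ℤ) (n : ι → ℕ) (hn : ∀ i κ, hi i κ ≤ lo i κ + n i) (hN : ∀ i, n i + 2 < (F.P Kt).sitesPerDir (k i))
    (hbox : ∀ i, pts (k i) (Λ i) = (castSite '' Set.Icc (lo i) (hi i) : Set (Site (F.P Kt) (k i))))
    (hZ : ∀ i, (boxPlaqs (lo i - 1) (hi i + 1) : Set (Plaq (F.P Kt) (k i))) ⊆ plaqsInside (pts (k i) (Z i)))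
    (hTG0 : ∀ i, T i = (box (fun κ => (hi i κ - lo i κ + 1).toNat) (lo i)).image fun x =>
      (⟨castSite (x - unitVec ⟨0, h0⟩), ⟨0, h0⟩⟩ : PBond (F.P Kt) (k i)))
    (hN5 : ∀ i κ, ((hi i κ - lo i κ + 1).toNat : ℤ) + 5 < (F.P Kt).sitesPerDir (k i))
    (K : ι → ℕ) (hK1 : ∀ i, 1 ≤ K i) (hKn : ∀ i κ, (hi i κ - lo i κ + 1).toNat ≤ K i)
    (ext : ∀ i, GaugeField (F.P Kt) (k i) SU2 → GaugeField (F.P Kt) (k i) SU2)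
    (hext : ∀ i Vk, ext i Vk = extend (pts (k i) (Λ i)) (shellGauge Vk (lo i) (hi i)) Vk)
    (hlohi : ∀ i, lo i ≤ hi i)
    {γ cJ bx : ℝ} (hγ : 0 < γ) (hcJ : 0 ≤ cJ) (hbx : 0 ≤ bx)
    (hbxM : ∀ i, 12 * ((F.P Kt).d : ℝ) * ((n i : ℝ) + 2) ^ 2 ≤ bx * (M i) ^ 2)
    {Cerr R 𝓐 : ι → ℝ} (hM : ∀ i, 1 ≤ (M i)) (hR : ∀ i, 0 < R i) (h𝓐 : ∀ i, 0 ≤ 𝓐 i)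
    {γ₀ : ℝ} (hγ₀ : 0 ≤ γ₀)
    -- (J1) the JOINT holomorphic extension of print's function in the datum perturbation and the field
    (hGj : ∀ i Vk, PlaqSmallOn (plaqsInside (pts (k i) (Z i ∩ (Λ i)ᶜ))) (eR i) Vk →
      ∃ 𝒢 : VecField (F.P Kt) (k i) (EuclideanSpace ℂ (Fin 3)) × VecField (F.P Kt) (k i) (EuclideanSpace ℂ (Fin 3)) → ℂ,
        DifferentiableOn ℂ 𝒢 (ball 0 (R i)) ∧
        (∀ z ∈ ball (0 : VecField (F.P Kt) (k i) (EuclideanSpace ℂ (Fin 3)) × VecField (F.P Kt) (k i) (EuclideanSpace ℂ (Fin 3))) (R i), ‖𝒢 z‖ ≤ 𝓐 i) ∧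
        ∀ p B' : VecField (F.P Kt) (k i) E3, ‖p‖ < R i → ‖B'‖ < R i →
          𝒢 (cplxVec p, cplxVec B') =
            ((fun177std (Node00.bgMSCoPOfRecord F 2 ν Kt (k i) (maxDomT ν.M₁ (Z i))) ν.M₁ (Z i) (k i)
              (expMul su2Chart B' (ext i (expMul su2Chart p Vk))) : ℝ) : ℂ))
    -- (L2) (1.7)–(1.9) p.358 for the Hessian of the slice function at `0`
    (h17 : ∀ i Vk, PlaqSmallOn (plaqsInside (pts (k i) (Z i ∩ (Λ i)ᶜ))) (eR i) Vk → ∀ X : GaugeSlice (pts (k i) (Λ i)) (T i) E3,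
      γ₀ * (∑ z ∈ box (fun κ => (hi i κ - lo i κ + 1).toNat + 3) (fun κ => lo i κ - 2), ∑ μ : Fin (F.P Kt).d, ∑ a : Fin 3,
          curl (fun b => ιA (pts (k i) (Λ i)) (T i) X (⟨castSite b.1, b.2⟩ : PBond (F.P Kt) (k i)) a) z ⟨0, h0⟩ μ ^ 2) -
        Cerr i * ‖X‖ ^ 2 ≤ ⟪X, (fderiv ℝ (rGrad (pts (k i) (Λ i)) (T i)
              (sliceFn (pts (k i) (Λ i)) (T i)
                (fun177std (Node00.bgMSCoPOfRecord F 2 ν Kt (k i) (maxDomT ν.M₁ (Z i))) ν.M₁ (Z i) (k i)) (ext i Vk))) 0) X⟫)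
    (hsm : ∀ i, Cerr i ≤ γ₀ / (2 * (3 * (K i : ℝ) ^ 2 + 2 * (K i : ℝ) ^ 4)))
    (hγle : ∀ i, γ / (M i) ^ 5 ≤ γ₀ / (2 * (3 * (K i : ℝ) ^ 2 + 2 * (K i : ℝ) ^ 4)))
    -- the geometric letter: the k-blocks over the bonds meeting `Λ^{(k)}` lie inside `Ω₁(Z)` (print: `Λ` deep inside `Z`)
    (hfar : ∀ i (b : PBond (F.P Kt) 0), b.src ∉ maxDomT ν.M₁ (Z i) 1 →
      (⟨blockIter (k i) b.src, b.dir⟩ : PBond (F.P Kt) (k i)) ∉ bondsOf (pts (k i) (Λ i)))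
    -- (Gᵃ) geometry of `Z`: a union of `k`-blocks (print's `Z` is a union of `M`-cubes of `T₁^{(k)}`; §4 derives it from the cube letter on the cover)
    (hZblk : ∀ i, IsBlockUnion (k i) (Z i))
    -- print's `M₁ ≥ 2` and the torus divisibility `L^{k}M₁ ∣ 2L^{m+K}` of the `LʲM₁`-cube partitions
    (hM2 : 2 ≤ ν.M₁) (hdiv : ∀ i, side (F.P Kt).L ν.M₁ (k i) ∣ (F.P Kt).sitesPerDir 0)
    -- bookkeeping constants
    {cE B₃ a₀ a₁' cA : ℝ} (hcE0 : 0 ≤ cE) (hcE : ∀ i, 12 * ((F.P Kt).d : ℝ) * ((n i : ℝ) + 2) ^ 2 ≤ cE) (hB₃ : 0 ≤ B₃)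
    (heRa : ∀ i, (cE + 1) * eR i ≤ a₁' ∧ B₃ * ((cE + 1) * eR i) ≤ ν.εreg) (ha₀ : ν.εreg ≤ a₀)
    (hcA : 1 / 2 * (B₃ * (cE + 1) * (F.P Kt).eta 1 ^ 2) ^ 2 * (Fintype.card (Plaq (F.P Kt) 0) : ℝ) ≤ cA)
    -- [15] THEOREM 1 (R), CLOSED GENERAL-SEQUENCE FORM, GUARDED, IN NODE 00's TORUS-NATIVE CLASS (shape (C)): indices over
    -- `fun j => Node00.unionsOfCubes P (LʲM₁)` (as `Node00.DOfRecord`), no separate cube letter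
    (h15T : ∀ (k' : ℕ), k' ≤ (F.P Kt).m + (F.P Kt).K → side (F.P Kt).L ν.M₁ k' ∣ (F.P Kt).sitesPerDir 0 →
      ∀ (s : B14.Eq218Concrete.Seq (fun n : ℕ => Node00.unionsOfCubes (F.P Kt) (side (F.P Kt).L ν.M₁ n)) k'),
      Node00.Sect2.SeqSeparated ν.M₁ s → 0 < ν.M₁ →
      ∀ (ε₀ : ℝ) (δ : ℕ → ℝ), (∀ j, j ≤ k' → 0 < δ j ∧ δ j ≤ a₁' ∧ B₃ * δ j ≤ ε₀) → (∀ j, j < k' → δ j ≤ 2 * δ (j + 1)) →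
      (∀ j, j < k' → δ (j + 1) ≤ 2 * δ j) → ε₀ ≤ a₀ →
      ∀ W : MSField (F.P Kt) SU2,
        Node00.Sect2.DataSmall7PTop (Node00.avOfRecord F 2 Kt) s.Ω (Node00.suppDomOfRecord F ν Kt s.Ω) k' δ W →
        ∀ U₀ : GaugeField (F.P Kt) 0 SU2, IsMinimizer (Node00.avOfRecord F 2 Kt)
            {U | (∀ j, j ≤ k' → PlaqSmallOn (Node00.Sect2.omegaPlaqsTop s.Ω (Node00.suppDomOfRecord F ν Kt s.Ω) j)
                (ε₀ * (F.P Kt).eta j ^ 2) U) ∧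
              Node00.Sect2.CoDivClassOnTop s.Ω (Node00.suppDomOfRecord F ν Kt s.Ω) k' ε₀ U}
            (genSet s.Ω k') W U₀ →
          (∀ j, j ≤ k' → PlaqSmallOn (Node00.Sect2.omegaPlaqsTop s.Ω (Node00.suppDomOfRecord F ν Kt s.Ω) j)
              (B₃ * δ j * (F.P Kt).eta j ^ 2) U₀) ∧
            ∀ j, j ≤ k' → Node00.Sect2.CoDivSmallOn (Node00.Sect2.omegaBondsTop s.Ω (Node00.suppDomOfRecord F ν Kt s.Ω) j)
              (B₃ * δ j * (F.P Kt).eta j ^ 3) U₀)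
    (hcJ' : ∀ i, 2 * cA * eR i / R i + 4 * 𝓐 i / (R i * eR i) ≤ cJ)
    : ∃ a₁ : ι → ℝ, (∀ i, 0 < a₁ i) ∧
      B15.Prop1Printed (lfVarOn su2Chart fun i =>
        InstOn.std (Node00.bgMSCoPOfRecord F 2 ν Kt (k i) (maxDomT ν.M₁ (Z i))) ν.M₁ (Z i) (Λ i) (k i) (M i) (a₁ i)
          (anExt (pts (k i) (Λ i)) (T i)
            (fun177std (Node00.bgMSCoPOfRecord F 2 ν Kt (k i) (maxDomT ν.M₁ (Z i))) ν.M₁ (Z i) (k i)) (ext i)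
            (min (1 / 2) (min (R i / 8) (γ / (M i) ^ 5 * (R i / 2) ^ 2 / (48 * (4 * 𝓐 i / R i + 1))))))) :=
  exists_domain_prop1Printed_lfVarOn_std_su2_box_intrinsic_analytic_atZSeqCoPRecord_ofThm1Guarded_oneSided ν Kt hd3 h0 hcl Z Λ k M hk0 hk eR heR
    T lo hi n hn hN hbox hZ hTG0 hN5 K hK1 hKn ext hext hlohi hγ hcJ hbx hbxM hM hR h𝓐 hγ₀ hGj h17 hsm hγle hfar hZblk hM2 hdiv hcE0 hcE hB₃
    heRa ha₀ hcA (thm1Guarded_of_thm1TorusClass ν Kt (le_trans one_le_two hM2) h15T) hcJ'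

/-- **ONE-SIDED (γ₀-generic (1.7)) edition** (the two-sided `hlead` of the source replaced by `h17`, `hsm`∕`hγle` in γ₀-form). ★★★ **PROPOSITION 1 [IV] AT PRINT'S (1.74) OBJECT, THE ANALYTIC INPUT IN PRINT'S (190) CURRENCY** —
`B15Prop1Thm1GeneralFormShapes.exists_domain_prop1Printed_lfVarOn_std_su2_box_intrinsic_analytic_atZSeqCoPRecord_ofThm1TorusClass` (p556967) VERBATIM but for
the joint-holomorphy letter: (J1) `hGj` (ONE ℂ-differentiable bounded extension of the ACTION `(p, B′) ↦ A(U_{k,Z}(exp(iB′)·ext(exp(ip)V_k)))`) is REPLACED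
by (J0ᵛ) `hBg` — ONE family of CONFIGURATIONS, bondwise in `M₂(ℂ)` with ℂ-differentiable entries bounded by `𝓐₀ i`, which at every real point of the ball IS
an `SU(2)` configuration carrying the value (1.77) ([Balaban1985Variational] Prop. 9 p. 309: «The minimal configuration U_k(V) … has an extension to an analytic
function of Gᶜ-valued small configurations V′» — any such family of (2.12) minimisers of the data inhabits (J0ᵛ), (1.77) being the value function; the letter is
NOT pinned to the `Classical.choose` selector `UminOfRecord` of NODE 00's `bgMSCoPOfRecord`, n12-w1's LOCATED-SELECTOR) — and the action bound becomes the
explicit `𝓐 i := |Plaq (F.P Kt) 0| · (1 + 8(𝓐₀ i)⁴)` (§3) in `hcJ'` and in the clause's radius; `h𝓐` disappears.  Every other binder and the conclusion as in p556967.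
[cite: Balaban1989LargeFieldI, (1.74) p.192, Prop. 1 (1.77)–(1.78) p.194 (incl. the last clause), p.193, (1.79) p.195; Balaban1989LargeFieldII, (1.7)–(1.9)
p.358, (1.12)–(1.13) p.359; Balaban1985Variational, (1) p.277, Thm 1 (8) p.279, Prop. 9 (190) p.309; Balaban1988Convergent, (2.12)–(2.14) pp.256–257,
(2.16)–(2.18) p.257] -/
theorem exists_domain_prop1Printed_lfVarOn_std_su2_box_intrinsic_analytic_atZSeqCoPRecord_ofThm1TorusClass_ofValueMatched_oneSided {F : T4Family}
    (ν : Node00.Stage7Numerics) (Kt : ℕ) (hd3 : 3 ≤ (F.P Kt).d) (h0 : 0 < (F.P Kt).d) {ι : Type}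
    [hdec : ∀ j, DecidableEq (PBond (F.P Kt) j)] (hcl : hdec = fun _ a b => Classical.propDecidable (a = b))
    (Z Λ : ι → Set (Site (F.P Kt) 0)) (k : ι → ℕ) (M : ι → ℝ) (hk0 : ∀ i, 0 < k i) (hk : ∀ i, k i ≤ (F.P Kt).m + (F.P Kt).K)
    (eR : ι → ℝ) (heR : ∀ i, 0 < eR i)
    (T : ∀ i, Finset (PBond (F.P Kt) (k i)))
    (lo hi : ι → Fin (F.P Kt).d → ℤ) (n : ι → ℕ) (hn : ∀ i κ, hi i κ ≤ lo i κ + n i) (hN : ∀ i, n i + 2 < (F.P Kt).sitesPerDir (k i))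
    (hbox : ∀ i, pts (k i) (Λ i) = (castSite '' Set.Icc (lo i) (hi i) : Set (Site (F.P Kt) (k i))))
    (hZ : ∀ i, (boxPlaqs (lo i - 1) (hi i + 1) : Set (Plaq (F.P Kt) (k i))) ⊆ plaqsInside (pts (k i) (Z i)))
    (hTG0 : ∀ i, T i = (box (fun κ => (hi i κ - lo i κ + 1).toNat) (lo i)).image fun x =>
      (⟨castSite (x - unitVec ⟨0, h0⟩), ⟨0, h0⟩⟩ : PBond (F.P Kt) (k i)))
    (hN5 : ∀ i κ, ((hi i κ - lo i κ + 1).toNat : ℤ) + 5 < (F.P Kt).sitesPerDir (k i))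
    (K : ι → ℕ) (hK1 : ∀ i, 1 ≤ K i) (hKn : ∀ i κ, (hi i κ - lo i κ + 1).toNat ≤ K i)
    (ext : ∀ i, GaugeField (F.P Kt) (k i) SU2 → GaugeField (F.P Kt) (k i) SU2)
    (hext : ∀ i Vk, ext i Vk = extend (pts (k i) (Λ i)) (shellGauge Vk (lo i) (hi i)) Vk)
    (hlohi : ∀ i, lo i ≤ hi i)
    {γ cJ bx : ℝ} (hγ : 0 < γ) (hcJ : 0 ≤ cJ) (hbx : 0 ≤ bx)
    (hbxM : ∀ i, 12 * ((F.P Kt).d : ℝ) * ((n i : ℝ) + 2) ^ 2 ≤ bx * (M i) ^ 2)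
    {Cerr R 𝓐₀ : ι → ℝ} (hM : ∀ i, 1 ≤ (M i)) (hR : ∀ i, 0 < R i)
    {γ₀ : ℝ} (hγ₀ : 0 ≤ γ₀)
    -- (J0ᵛ) ONE family along the chart family with ℂ-differentiable bounded matrix entries which at every real point IS an `SU(2)` configuration carrying
    -- the VALUE (1.77) — print's (190) currency (any holomorphic family of (2.12) minimisers inhabits it); not pinned to the selector `UminOfRecord`
    (hBg : ∀ i Vk, PlaqSmallOn (plaqsInside (pts (k i) (Z i ∩ (Λ i)ᶜ))) (eR i) Vk →
      ∃ Ũ : VecField (F.P Kt) (k i) (EuclideanSpace ℂ (Fin 3)) × VecField (F.P Kt) (k i) (EuclideanSpace ℂ (Fin 3)) →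
          PBond (F.P Kt) 0 → Matrix (Fin 2) (Fin 2) ℂ,
        (∀ b a c, DifferentiableOn ℂ (fun z => Ũ z b a c) (ball 0 (R i))) ∧
        (∀ z ∈ ball (0 : VecField (F.P Kt) (k i) (EuclideanSpace ℂ (Fin 3)) × VecField (F.P Kt) (k i) (EuclideanSpace ℂ (Fin 3))) (R i),
          ∀ b a c, ‖Ũ z b a c‖ ≤ 𝓐₀ i) ∧
        ∀ p B' : VecField (F.P Kt) (k i) E3, ‖p‖ < R i → ‖B'‖ < R i → ∃ U' : GaugeField (F.P Kt) 0 SU2,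
          (∀ b, Ũ (cplxVec p, cplxVec B') b = ((U' b : SU2) : Matrix (Fin 2) (Fin 2) ℂ)) ∧
            wilsonAction4 U' =
              fun177std (Node00.bgMSCoPOfRecord F 2 ν Kt (k i) (maxDomT ν.M₁ (Z i))) ν.M₁ (Z i) (k i)
                (expMul su2Chart B' (ext i (expMul su2Chart p Vk))))
    -- (L2) (1.7)–(1.9) p.358 for the Hessian of the slice function at `0`
    (h17 : ∀ i Vk, PlaqSmallOn (plaqsInside (pts (k i) (Z i ∩ (Λ i)ᶜ))) (eR i) Vk → ∀ X : GaugeSlice (pts (k i) (Λ i)) (T i) E3,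
      γ₀ * (∑ z ∈ box (fun κ => (hi i κ - lo i κ + 1).toNat + 3) (fun κ => lo i κ - 2), ∑ μ : Fin (F.P Kt).d, ∑ a : Fin 3,
          curl (fun b => ιA (pts (k i) (Λ i)) (T i) X (⟨castSite b.1, b.2⟩ : PBond (F.P Kt) (k i)) a) z ⟨0, h0⟩ μ ^ 2) -
        Cerr i * ‖X‖ ^ 2 ≤ ⟪X, (fderiv ℝ (rGrad (pts (k i) (Λ i)) (T i)
              (sliceFn (pts (k i) (Λ i)) (T i)
                (fun177std (Node00.bgMSCoPOfRecord F 2 ν Kt (k i) (maxDomT ν.M₁ (Z i))) ν.M₁ (Z i) (k i)) (ext i Vk))) 0) X⟫)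
    (hsm : ∀ i, Cerr i ≤ γ₀ / (2 * (3 * (K i : ℝ) ^ 2 + 2 * (K i : ℝ) ^ 4)))
    (hγle : ∀ i, γ / (M i) ^ 5 ≤ γ₀ / (2 * (3 * (K i : ℝ) ^ 2 + 2 * (K i : ℝ) ^ 4)))
    -- the geometric letter: the k-blocks over the bonds meeting `Λ^{(k)}` lie inside `Ω₁(Z)`
    (hfar : ∀ i (b : PBond (F.P Kt) 0), b.src ∉ maxDomT ν.M₁ (Z i) 1 →
      (⟨blockIter (k i) b.src, b.dir⟩ : PBond (F.P Kt) (k i)) ∉ bondsOf (pts (k i) (Λ i)))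
    -- (Gᵃ) geometry of `Z`: a union of `k`-blocks
    (hZblk : ∀ i, IsBlockUnion (k i) (Z i))
    -- print's `M₁ ≥ 2` and the torus divisibility `L^{k}M₁ ∣ 2L^{m+K}`
    (hM2 : 2 ≤ ν.M₁) (hdiv : ∀ i, side (F.P Kt).L ν.M₁ (k i) ∣ (F.P Kt).sitesPerDir 0)
    -- bookkeeping constants
    {cE B₃ a₀ a₁' cA : ℝ} (hcE0 : 0 ≤ cE) (hcE : ∀ i, 12 * ((F.P Kt).d : ℝ) * ((n i : ℝ) + 2) ^ 2 ≤ cE) (hB₃ : 0 ≤ B₃)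
    (heRa : ∀ i, (cE + 1) * eR i ≤ a₁' ∧ B₃ * ((cE + 1) * eR i) ≤ ν.εreg) (ha₀ : ν.εreg ≤ a₀)
    (hcA : 1 / 2 * (B₃ * (cE + 1) * (F.P Kt).eta 1 ^ 2) ^ 2 * (Fintype.card (Plaq (F.P Kt) 0) : ℝ) ≤ cA)
    -- [15] THEOREM 1 (R), CLOSED GENERAL-SEQUENCE FORM, GUARDED, IN NODE 00's TORUS-NATIVE CLASS (shape (C)) — served by K0⁷'s def (n12-d 12Q⁵)
    (h15T : ∀ (k' : ℕ), k' ≤ (F.P Kt).m + (F.P Kt).K → side (F.P Kt).L ν.M₁ k' ∣ (F.P Kt).sitesPerDir 0 →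
      ∀ (s : B14.Eq218Concrete.Seq (fun n : ℕ => Node00.unionsOfCubes (F.P Kt) (side (F.P Kt).L ν.M₁ n)) k'),
      Node00.Sect2.SeqSeparated ν.M₁ s → 0 < ν.M₁ →
      ∀ (ε₀ : ℝ) (δ : ℕ → ℝ), (∀ j, j ≤ k' → 0 < δ j ∧ δ j ≤ a₁' ∧ B₃ * δ j ≤ ε₀) → (∀ j, j < k' → δ j ≤ 2 * δ (j + 1)) →
      (∀ j, j < k' → δ (j + 1) ≤ 2 * δ j) → ε₀ ≤ a₀ →
      ∀ W : MSField (F.P Kt) SU2,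
        Node00.Sect2.DataSmall7PTop (Node00.avOfRecord F 2 Kt) s.Ω (Node00.suppDomOfRecord F ν Kt s.Ω) k' δ W →
        ∀ U₀ : GaugeField (F.P Kt) 0 SU2, IsMinimizer (Node00.avOfRecord F 2 Kt)
            {U | (∀ j, j ≤ k' → PlaqSmallOn (Node00.Sect2.omegaPlaqsTop s.Ω (Node00.suppDomOfRecord F ν Kt s.Ω) j)
                (ε₀ * (F.P Kt).eta j ^ 2) U) ∧
              Node00.Sect2.CoDivClassOnTop s.Ω (Node00.suppDomOfRecord F ν Kt s.Ω) k' ε₀ U}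
            (genSet s.Ω k') W U₀ →
          (∀ j, j ≤ k' → PlaqSmallOn (Node00.Sect2.omegaPlaqsTop s.Ω (Node00.suppDomOfRecord F ν Kt s.Ω) j)
              (B₃ * δ j * (F.P Kt).eta j ^ 2) U₀) ∧
            ∀ j, j ≤ k' → Node00.Sect2.CoDivSmallOn (Node00.Sect2.omegaBondsTop s.Ω (Node00.suppDomOfRecord F ν Kt s.Ω) j)
              (B₃ * δ j * (F.P Kt).eta j ^ 3) U₀)
    (hcJ' : ∀ i, 2 * cA * eR i / R i + 4 * ((Fintype.card (Plaq (F.P Kt) 0) : ℝ) * (1 + 8 * 𝓐₀ i ^ 4)) / (R i * eR i) ≤ cJ)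
    : ∃ a₁ : ι → ℝ, (∀ i, 0 < a₁ i) ∧
      B15.Prop1Printed (lfVarOn su2Chart fun i =>
        InstOn.std (Node00.bgMSCoPOfRecord F 2 ν Kt (k i) (maxDomT ν.M₁ (Z i))) ν.M₁ (Z i) (Λ i) (k i) (M i) (a₁ i)
          (anExt (pts (k i) (Λ i)) (T i)
            (fun177std (Node00.bgMSCoPOfRecord F 2 ν Kt (k i) (maxDomT ν.M₁ (Z i))) ν.M₁ (Z i) (k i)) (ext i)
            (min (1 / 2) (min (R i / 8) (γ / (M i) ^ 5 * (R i / 2) ^ 2 /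
              (48 * (4 * ((Fintype.card (Plaq (F.P Kt) 0) : ℝ) * (1 + 8 * 𝓐₀ i ^ 4)) / R i + 1))))))) :=
  exists_domain_prop1Printed_lfVarOn_std_su2_box_intrinsic_analytic_atZSeqCoPRecord_ofThm1TorusClass_oneSided ν Kt hd3 h0 hcl Z Λ k M hk0 hk eR heR
    T lo hi n hn hN hbox hZ hTG0 hN5 K hK1 hKn ext hext hlohi hγ hcJ hbx hbxM (𝓐 := fun i => (Fintype.card (Plaq (F.P Kt) 0) : ℝ) * (1 + 8 * 𝓐₀ i ^ 4))
    hM hR (fun i => by positivity) hγ₀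
    (fun i Vk hV => jointHolomorphic_fun177std_of_valueMatched _ _ _ _ _ _ (hBg i Vk hV)) h17 hsm hγle hfar hZblk hM2 hdiv hcE0 hcE hB₃
    heRa ha₀ hcA h15T hcJ'

end AtRecord

end Literature.MathematicalPhysics.QuantumFieldTheory.Balaban1983to89.B15Prop1OneSidedIneq17Edition
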